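import Summits.BirchSwinnertonDyer.BirchSwinnertonDyer.Theorems.SignedLowerHalvesSmallImageLowerHalfBothSignsRttJunctionLocalFrame
import Literature.NumberTheory.GaloisRepresentations.CyclotomicCharacterFrobeniusProofs
import Literature.NumberTheory.GaloisRepresentations.LocalKroneckerWeberInertiaProofs
import Literature.NumberTheory.EllipticCurves.ZpExtensionUnitTwistProofs
import Literature.NumberTheory.EllipticCurves.CyclotomicZpExtension
import Literature.NumberTheory.EllipticCurves.PAdicBSD
import Literature.NumberTheory.EllipticCurves.GreenbergVatsal2000.NonPrimitivePAdicLFunction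
import Literature.NumberTheory.EllipticCurves.SharpFlatPAdicLFunctionCoeffField
import Summits.BirchSwinnertonDyer.Rank1Residual.X2.EulerFactorAlgebra
import Summits.BirchSwinnertonDyer.BirchSwinnertonDyer.Theorems.ResidualThetaTransportAtTwoResidualSignedLambdaLowerCMAtTwoRelayDescends
import HarnessLib

/-!
# Route `SignedLowerHalves`, crux L `SmallImageLowerHalfBothSigns` (stmt-BirchSwinnertonDyer-23599), line `rtt_w3` v24 — row **S1c** (the Euler identity of the
# structural depletion), part 1: THE ORIENTATION DICTIONARY — `x_w = −deg(w)·f_ℓ`, `u_w = N(w)/θ(φ_w)`, and the power-series algebra of one depletion factor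

INPUTS hand `bsd-inputs-honda-p1` g27 under LEAD `cruxlead-stmt-BirchSwinnertonDyer-23599` g13 (cell `bsd-ssimc`); helper `--supports stmt-BirchSwinnertonDyer-23599`.
THEOREMS ONLY: no definition, no named fact, no instance, no `sorry`. Audit of record: `Lines/…` evidence #44 on the item (`AUDIT-S1c-orientation-honda-g27.md`).

WHAT. Row S1 (honda g26, p810260) exports the structural depletion `E = p^d · ∏_{w∈T} ((1+T)^{x_w} − C(θ′(φ_w)·χ_p(φ_w)))` of honda's cyclotomic model
`I` (generator `γK⁻¹`), with `hx : γK⁻¹^{x_w mod pⁿ}·φ_w⁻¹ ∈ U_n`. Row S1c must identify `ι(E) ∈ ℚ̄_p⟦T⟧` with an Euler product. This file proves the dictionary: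
* §1 `toAdd_apply_eq_ell` — a cyclotomic `κ : Γ_ℚ → ℤ_p` with `κ γ = 1` for a `γ` matching the cyclotomic variable (`χ_p(γ)·ζ = γ_cyc`) IS the normalised one:
  `κ σ = ell(χ_p σ)` for every `σ` (uniqueness up to units + `ell(γ_cyc ζ⁻¹) = 1`).
* §2 `toAdd_restrict_eq_natCast_mul_frobeniusExponent` — for `[K:ℚ] = 2`, a place `w ∣ ℓ ≠ p` with `N(w) = ℓ^m` and an arithmetic Frobenius `φ` at a prime above `w`:
  `κK(φ) = m · f_ℓ` (`χ_p(φ) = N w`, `ell` multiplicative); hence ★ `eq_neg_natCast_mul_frobeniusExponent_of_mem_layerSubgroup`: S1's exponent clause forces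
  **`x_w = −(m · f_ℓ)`** — the depletion lives at `(1+T)^{−f_ℓ}`, the INVERSE of the variable `(1+T)^{+f_ℓ}` of Greenberg–Vatsal's `P_ℓ(ℓ⁻¹(1+T)^{f_ℓ})`.
* §3 power-series algebra: `binomialSeries_natCast_mul` (`(1+T)^{m r} = ((1+T)^r)^m`), `iwasawaOToPowerSeries_binomialSeries`, and ★ `depletionFactor_eq_C_mul_aeval`:
  `Y^m − C(t′ q^m) = C(−t′ q^m) · aeval (C q′ · Y) (1 − C t · X^m)` (`tt′ = qq′ = 1`) — one depletion factor IS, up to the unit `−N(w)/θ(φ_w)`, the Euler factor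
  `1 − θ(φ_w) X^{deg w}` evaluated at `ℓ⁻¹ (1+T)^{−f_ℓ}`.
* §4 places: `exists_residueCard_eq_pow` (`N(w) = ℓ^m`), ★ `mem_filter_iff_mem_and_isUnramifiedAt` (the places of `T = S₀K ∖ supp(p𝔣)` over `ℓ_v`, `v ∈ S₀`, are EXACTLY the
  places over `ℓ_v` at which `θ` is unramified — (R)/(U) of `CharRoadFrameSupp` + `θ′·θ₀₀ = 1`), `eq_biUnion_filter`/`pairwiseDisjoint_filter` (`T` is the disjoint union of
  its fibres over `S₀`). Part 2 (`…RttJunctionEulerId`) assembles the v25 row S1c from these and the print dictionary `P_{g,ℓ} = ∏_{w∣ℓ, θ unram.}(1 − θ(φ_w)₀₀ X^{deg w})`.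
HONEST FRAMING: bookkeeping; S1c (which needs the PRINT identification `P_{g,ℓ} = ∏_{w∣ℓ, θ unram.} (1 − θ(φ_w) X^{deg w})`, Miyake Thm 4.8.2 + 4.6.19), E2, crux L, crux M
and BSD remain OPEN; BSD is proved for NO curve.

References: [Washington1997] §13.1–13.2; [SerreAbelianLadic1968] Ch. I §1.2; [GreenbergVatsal2000] §1 p. 9, §2 Prop. (2.4); [MazurTateTeitelbaum1986Invent] §I.13;
[PerrinRiou1994Invent] §1.3.
-/

set_option autoImplicit false
set_option linter.dupNamespace false -- D-0017: single-problem summit, the namespace repeats the problem name by design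
noncomputable section

open scoped Classical
open NumberField IsDedekindDomain Field PowerSeries Rat.HeightOneSpectrum

namespace Summit.BirchSwinnertonDyer.BirchSwinnertonDyer.Theorems.SmallImageRttJunctionEuler

open Literature.NumberTheory.EllipticCurves Literature.NumberTheory.GaloisRepresentations
  Literature.NumberTheory.ComplexMultiplication.EllipticUnits Literature.NumberTheory.ComplexMultiplication.EllipticUnits.JohnsonLeungKings2011
  Summit.BirchSwinnertonDyer.BirchSwinnertonDyer.Theorems.SmallImageRttD2J1 Summit.BirchSwinnertonDyer.BirchSwinnertonDyer.Theorems.SmallImageRttD2Seq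
  IsDedekindDomain.HeightOneSpectrum Literature.NumberTheory.EllipticCurves.GreenbergVatsal2000

/-! ## §1 A cyclotomic `κ` normalised on a cyclotomic variable is `ell ∘ χ_p` -/

section Ell

variable {p : ℕ} [Fact p.Prime]

/-- **`ell(χ_p γ) = 1` for a cyclotomic variable `γ`** (`χ_p(γ)·ζ = γ_cyc`, `ζ` of finite order: `ell` kills `μ(ℤ_p)` and `ell(γ_cyc) = 1`).
[cite: MazurTateTeitelbaum1986Invent, §I.13] [cite: Washington1997, §13.1] -/
theorem ell_cyclotomicCharacter_eq_one {γ : absoluteGaloisGroup ℚ} (hcv : IsCyclotomicVariable p γ) :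
    CyclotomicZp.ell p (GaloisRep.cyclotomicCharacter ℚ p γ) = 1 := by
  obtain ⟨ζ, hζ, hprod⟩ := hcv
  have hunit : GaloisRep.cyclotomicCharacter ℚ p γ * ζ = CyclotomicZp.cycPowUnit p 1 :=
    Units.ext (by rw [hprod, CyclotomicZp.val_cycPowUnit, CyclotomicZp.cycPow_one])
  have h1 : CyclotomicZp.ell p (GaloisRep.cyclotomicCharacter ℚ p γ * ζ) = 1 := by
    rw [hunit, CyclotomicZp.ell_cycPowUnit]
  rwa [CyclotomicZp.ell_mul, (CyclotomicZp.ell_eq_zero_iff p ζ).mpr hζ, add_zero] at h1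

/-- ★ **A cyclotomic `ℤ_p`-extension of `ℚ` normalised on a cyclotomic variable is the normalised logarithm of the cyclotomic character**: if `κ` is cyclotomic,
`κ γ = 1` and `χ_p(γ)·ζ = γ_cyc`, then `κ σ = ell(χ_p σ)` for EVERY `σ ∈ Γ_ℚ` (`κ` and `ell ∘ χ_p` have the same kernel, so differ by a unit `u`
(`IsCyclotomic.exists_eq_unitTwist`); evaluating at `γ` gives `u = 1`). [cite: Washington1997, §13.1] [cite: MazurTateTeitelbaum1986Invent, §I.13] -/
theorem toAdd_apply_eq_ell {κ : ZpExtension ℚ p} (hκ : κ.IsCyclotomic) {γ : absoluteGaloisGroup ℚ} (hγ : κ.IsTopGenerator γ)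
    (hcv : IsCyclotomicVariable p γ) (σ : absoluteGaloisGroup ℚ) :
    (κ σ).toAdd = CyclotomicZp.ell p (GaloisRep.cyclotomicCharacter ℚ p σ) := by
  obtain ⟨u, hu⟩ := ZpExtension.IsCyclotomic.exists_eq_unitTwist_holds (CyclotomicZp.isCyclotomic_zpExtension p) hκ
  have hγ' : (κ γ).toAdd = 1 := by
    rw [ZpExtension.IsTopGenerator] at hγ
    rw [hγ, toAdd_ofAdd]
  have hu1 : (u : ℤ_[p]) = 1 := by
    have h := hγ'
    rw [hu, ZpExtension.unitTwist_apply, toAdd_ofAdd, CyclotomicZp.zpExtension_apply, toAdd_ofAdd, ell_cyclotomicCharacter_eq_one hcv, mul_one] at h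
    exact h
  rw [hu, ZpExtension.unitTwist_apply, toAdd_ofAdd, CyclotomicZp.zpExtension_apply, toAdd_ofAdd, hu1, one_mul]

/-- `ell` is additive on powers: `ell(v^m) = m · ell(v)`. [cite: Washington1997, §13.1] -/
theorem ell_pow (v : ℤ_[p]ˣ) (m : ℕ) : CyclotomicZp.ell p (v ^ m) = (m : ℤ_[p]) * CyclotomicZp.ell p v := by
  induction m with
  | zero => rw [pow_zero, CyclotomicZp.ell_one, Nat.cast_zero, zero_mul]
  | succ m ih => rw [pow_succ, CyclotomicZp.ell_mul, ih, Nat.cast_succ, add_mul, one_mul]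

/-- `ell` of a unit whose value is `ℓ^m` is `m · f_ℓ` (`f_ℓ = frobeniusExponent p ℓ`, `ℓ` prime to `p`). [cite: GreenbergVatsal2000, §1 p. 9] -/
theorem ell_eq_natCast_mul_frobeniusExponent {ℓ : ℕ} (hℓ : p.Coprime ℓ) (m : ℕ) (u : ℤ_[p]ˣ) (hu : (u : ℤ_[p]) = (ℓ : ℤ_[p]) ^ m) :
    CyclotomicZp.ell p u = (m : ℤ_[p]) * frobeniusExponent p (ℓ : ℤ_[p]) := by
  have hℓu : IsUnit (ℓ : ℤ_[p]) := Summit.BirchSwinnertonDyer.Rank1Residual.X2.EulerFactorAlgebra.isUnit_natCast_of_coprime hℓ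
  rw [frobeniusExponent_of_isUnit hℓu]
  have hueq : u = hℓu.unit ^ m := Units.ext (by rw [hu, Units.val_pow_eq_pow_val, IsUnit.unit_spec])
  rw [hueq, ell_pow]

end Ell

/-! ## §2 The exponent of an arithmetic Frobenius on the cyclotomic `ℤ_p`-extension of a quadratic field -/

section Exponent

variable {p : ℕ} [Fact p.Prime] (hp : p ≠ 2) {κ : ZpExtension ℚ p} {K : Type} [Field K] [NumberField K] (hK2 : Module.finrank ℚ K = 2)

/-- **`κK(φ) = m · f_ℓ`**: for the restricted cyclotomic `ℤ_p`-extension `κK = κ ∘ res` of `K` (`κ` cyclotomic over `ℚ`, normalised on a cyclotomic variable), a finite place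
`w` of `K` with `ℓ ∈ w`, `ℓ ≠ p`, `N(w) = ℓ^m`, a prime `𝔓 ∣ w` of `\bar ℤ_K` and an ARITHMETIC Frobenius `φ` at `𝔓`: `κK(φ) = m · f_ℓ` (`χ_p(res φ) = χ_p(φ) = N(w)`,
Serre I-1.2; `ell(ℓ^m) = m·ell(ℓ)`). [cite: SerreAbelianLadic1968, Ch. I §1.2] [cite: GreenbergVatsal2000, §1 p. 9] [cite: Washington1997, §13.1] -/
theorem toAdd_restrict_eq_natCast_mul_frobeniusExponent (hκ : κ.IsCyclotomic) {γ : absoluteGaloisGroup ℚ} (hγ : κ.IsTopGenerator γ)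
    (hcv : IsCyclotomicVariable p γ) {w : HeightOneSpectrum (𝓞 K)} {ℓ : ℕ} (hℓ : ℓ.Prime) (hℓp : ℓ ≠ p) (hℓw : (ℓ : 𝓞 K) ∈ w.asIdeal) {m : ℕ}
    (hm : w.residueCard = ℓ ^ m) {𝔓 : Ideal (absIntegers (𝓞 K) K)} (h𝔓 : 𝔓 ∈ w.primesAbove) {φ : absoluteGaloisGroup K} (hφ : IsArithFrobAt (𝓞 K) φ 𝔓) :
    (κ.restrictOfFinrankEqTwo hp K hK2 φ).toAdd = (m : ℤ_[p]) * frobeniusExponent p (ℓ : ℤ_[p]) := by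
  have hpw : ((p : ℕ) : 𝓞 K) ∉ w.asIdeal := SmallImageRttJunctionLocal.natCast_not_mem_of_natCast_mem hℓ Fact.out hℓp hℓw
  rw [ZpExtension.restrictOfFinrankEqTwo_apply, toAdd_apply_eq_ell hκ hγ hcv,
    Literature.NumberTheory.GaloisRepresentations.cyclotomicCharacter_absGaloisRestrict ℚ K p φ]
  refine ell_eq_natCast_mul_frobeniusExponent ((Nat.coprime_primes Fact.out hℓ).mpr (Ne.symm hℓp)) m _ ?_
  rw [GaloisRep.cyclotomicCharacter_apply_of_isArithFrobAt hpw h𝔓 hφ, hm, Nat.cast_pow]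

/-- ★ **S1's exponent clause forces `x_w = −(m · f_ℓ)`**: if `γK` is a normalised topological generator of `κK` (`κK γK = 1`) and
`γK⁻¹^{x mod pⁿ} · φ⁻¹ ∈ U_n` for all `n` (the binder `hx` of rows S1/S1c, honda's model being generated by `γK⁻¹`), then `κK(φ) = −x`, so for an arithmetic
Frobenius `φ` at a place `w ∣ ℓ ≠ p` with `N(w) = ℓ^m`: `x = −(m · f_ℓ)`. The depletion factor `(1+T)^{x_w}` therefore reads `((1+T)^{f_ℓ})^{−m}` in `ℚ̄_p⟦T⟧`.
[cite: Washington1997, §13.2] [cite: GreenbergVatsal2000, §1 p. 9] -/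
theorem eq_neg_natCast_mul_frobeniusExponent_of_mem_layerSubgroup (hκ : κ.IsCyclotomic) {γ : absoluteGaloisGroup ℚ} (hγ : κ.IsTopGenerator γ)
    (hcv : IsCyclotomicVariable p γ) {γK : absoluteGaloisGroup K} (hγK : (κ.restrictOfFinrankEqTwo hp K hK2).IsTopGenerator γK)
    {w : HeightOneSpectrum (𝓞 K)} {ℓ : ℕ} (hℓ : ℓ.Prime) (hℓp : ℓ ≠ p) (hℓw : (ℓ : 𝓞 K) ∈ w.asIdeal) {m : ℕ} (hm : w.residueCard = ℓ ^ m)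
    {𝔓 : Ideal (absIntegers (𝓞 K) K)} (h𝔓 : 𝔓 ∈ w.primesAbove) {φ : absoluteGaloisGroup K} (hφ : IsArithFrobAt (𝓞 K) φ 𝔓) {x : ℤ_[p]}
    (hx : ∀ n : ℕ, γK⁻¹ ^ (PadicInt.toZModPow n x).val * φ⁻¹ ∈ (κ.restrictOfFinrankEqTwo hp K hK2).layerSubgroup n) :
    x = -((m : ℤ_[p]) * frobeniusExponent p (ℓ : ℤ_[p])) := by
  rw [← toAdd_restrict_eq_natCast_mul_frobeniusExponent hp hK2 hκ hγ hcv hℓ hℓp hℓw hm h𝔓 hφ]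
  set κK := κ.restrictOfFinrankEqTwo hp K hK2 with hκK
  -- `κK(γK⁻¹^{j} φ⁻¹) = -j - κK φ` with `j = (x mod pⁿ).val`, divisible by `pⁿ`
  refine PadicInt.ext_of_toZModPow.mp fun n ↦ ?_
  have h := ZpExtension.mem_layerSubgroup.mp (hx n)
  rw [map_mul, map_pow, map_inv, map_inv, toAdd_mul, toAdd_pow, toAdd_inv, toAdd_inv] at h
  rw [ZpExtension.IsTopGenerator] at hγK
  rw [hγK, toAdd_ofAdd, smul_neg, nsmul_eq_mul, mul_one] at h
  -- `pⁿ ∣ -(j : ℤ_p) - κK φ` ⇒ `toZModPow n x = toZModPow n (-(κK φ))`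
  have hker : PadicInt.toZModPow n (-(((PadicInt.toZModPow n x).val : ℕ) : ℤ_[p]) + -(κK φ).toAdd) = 0 := by
    rw [← RingHom.mem_ker, PadicInt.ker_toZModPow, Ideal.mem_span_singleton]
    exact h
  rw [map_add, map_neg, map_neg, map_natCast, ZMod.natCast_zmod_val, ← neg_add, neg_eq_zero, add_eq_zero_iff_eq_neg] at hker
  rw [map_neg, hker]

end Exponent

/-! ## §3 Power-series algebra of one depletion factor -/

section Algebra

variable {p : ℕ} [Fact p.Prime] (S : Set (PadicAlgCl p))

/-- **`(1+T)^{m·r} = ((1+T)^r)^m`** for the binomial series over a binomial ring (`binomialSeries_add`). [cite: Washington1997, §7.1] -/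
theorem binomialSeries_natCast_mul {R A : Type*} [CommRing R] [BinomialRing R] [CommRing A] [Algebra R A] (m : ℕ) (r : R) :
    binomialSeries A ((m : R) * r) = binomialSeries A r ^ m := by
  induction m with
  | zero => rw [Nat.cast_zero, zero_mul, binomialSeries_zero, pow_zero]
  | succ m ih => rw [Nat.cast_succ, add_mul, one_mul, binomialSeries_add, ih, pow_succ]

/-- **`(1+T)^{−r} · (1+T)^{r} = 1`**: binomial series at opposite exponents are mutually inverse. [cite: Washington1997, §7.1] -/
theorem binomialSeries_neg_mul_self {R A : Type*} [CommRing R] [BinomialRing R] [CommRing A] [Algebra R A] (r : R) :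
    binomialSeries A (-r) * binomialSeries A r = 1 := by
  rw [← binomialSeries_add, neg_add_cancel, binomialSeries_zero]

/-- The image in `ℚ̄_p⟦T⟧` of `(1+T)^x ∈ Λ` pushed to `Λ_𝒪`: the binomial series with coefficients mapped along `ℤ_p → ℚ̄_p`.
[cite: Sprung2017, Thm. 1.1 (`Λ = 𝒪[[T]]`; plumbing)] -/
theorem iwasawaOToPowerSeries_binomialSeries (x : ℤ_[p]) :
    iwasawaOToPowerSeries S (iwasawaToIwasawaO S (binomialSeries ℤ_[p] x)) = (binomialSeries ℤ_[p] x).map (algebraMap ℤ_[p] (PadicAlgCl p)) := by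
  rw [iwasawaOToPowerSeries_iwasawaToIwasawaO, iwasawaToPowerSeries, ← RingHom.comp_apply, ← PowerSeries.map_comp,
    ← IsScalarTower.algebraMap_eq ℤ_[p] ℚ_[p] (PadicAlgCl p)]

/-- `padicIntToCoeffIntegers` of a natural number, read in `ℚ̄_p`, is that natural number. [cite: EmertonPollackWeston2006, §3.1 (p. 17) (plumbing)] -/
theorem coe_padicIntToCoeffIntegers_natCast_pow (ℓ m : ℕ) :
    ((padicIntToCoeffIntegers S (((ℓ : ℤ_[p]) ^ m)) : padicCoeffIntegers S) : PadicAlgCl p) = (ℓ : PadicAlgCl p) ^ m := by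
  rw [map_pow, map_natCast]
  push_cast
  rfl

/-- ★ **ONE DEPLETION FACTOR IS A UNIT TIMES AN EVALUATED EULER FACTOR**: in any commutative ring, for `t t' = 1`, `q q' = 1`, any `m` and any `Y`,
`Y^m − C(t' q^m) = C(−(t' q^m)) · aeval (C q' · Y) (1 − C t · X^m)` — with `Y = (1+T)^{−f_ℓ}`, `q = ℓ`, `t = θ(φ_w)`, `m = deg w` this says that the `w`-factor
`(1+T)^{x_w} − N(w)/θ(φ_w)` of the structural depletion is `−N(w)/θ(φ_w)` times the Euler factor `1 − θ(φ_w) X^{deg w}` at `X = ℓ⁻¹(1+T)^{−f_ℓ}`.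
[cite: GreenbergVatsal2000, §2 Prop. (2.4)] [cite: PerrinRiou1994Invent, §1.3] -/
theorem depletionFactor_eq_C_mul_aeval {F : Type*} [CommRing F] {t t' q q' : F} (ht : t * t' = 1) (hq : q * q' = 1) (m : ℕ) (Y : PowerSeries F) :
    Y ^ m - PowerSeries.C (t' * q ^ m) =
      PowerSeries.C (-(t' * q ^ m)) * Polynomial.aeval (PowerSeries.C q' * Y) (1 - Polynomial.C t * Polynomial.X ^ m) := by
  have h1 : (PowerSeries.C t : PowerSeries F) * PowerSeries.C t' = 1 := by rw [← map_mul, ht, map_one]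
  have h2 : (PowerSeries.C q : PowerSeries F) ^ m * PowerSeries.C q' ^ m = 1 := by rw [← mul_pow, ← map_mul, hq, map_one, one_pow]
  simp only [map_sub, map_one, map_mul, map_pow, map_neg, Polynomial.aeval_C, Polynomial.aeval_X, PowerSeries.algebraMap_eq]
  linear_combination (-(Y ^ m * (PowerSeries.C q ^ m * PowerSeries.C q' ^ m))) * h1 + (-(Y ^ m)) * h2

end Algebra

/-! ## §4 Places: residue degrees, the unramified places over `ℓ ∈ S₀`, and the grouping of `T` by the rational prime below -/

section Places

variable {p : ℕ} [Fact p.Prime] {K : Type} [Field K] [NumberField K]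

omit [Fact p.Prime] in
/-- **`N(w) = ℓ^m` for a place `w ∣ ℓ`** (`𝓞 K ⧸ w` is a finite field of characteristic `ℓ`; Mathlib `Ideal.absNorm_eq_pow_inertiaDeg'`). [cite: NeukirchANT1999, Ch. I §8] -/
theorem exists_residueCard_eq_pow {w : HeightOneSpectrum (𝓞 K)} {ℓ : ℕ} (hℓ : ℓ.Prime) (hℓw : (ℓ : 𝓞 K) ∈ w.asIdeal) : ∃ m : ℕ, w.residueCard = ℓ ^ m := by
  have hmax : (Ideal.span {(ℓ : ℤ)}).IsMaximal := PrincipalIdealRing.isMaximal_of_irreducible (Nat.prime_iff_prime_int.mp hℓ).irreducible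
  have hle : Ideal.span {(ℓ : ℤ)} ≤ w.asIdeal.under ℤ := by
    rw [Ideal.span_le, Set.singleton_subset_iff]
    change algebraMap ℤ (𝓞 K) ℓ ∈ w.asIdeal
    rwa [map_natCast]
  haveI : w.asIdeal.LiesOver (Ideal.span {(ℓ : ℤ)}) := ⟨hmax.eq_of_le (Ideal.comap_ne_top _ w.isPrime.ne_top) hle⟩
  exact ⟨_, by rw [HeightOneSpectrum.residueCard_eq_card_quotient, ← Submodule.cardQuot_apply, ← Ideal.absNorm_apply, Ideal.absNorm_eq_pow_inertiaDeg' w.asIdeal hℓ]⟩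

omit [Fact p.Prime] in
/-- `N(w) = ℓ ^ (Nat.log ℓ (N w))` for `w ∣ ℓ`. [cite: NeukirchANT1999, Ch. I §8] -/
theorem residueCard_eq_pow_log {w : HeightOneSpectrum (𝓞 K)} {ℓ : ℕ} (hℓ : ℓ.Prime) (hℓw : (ℓ : 𝓞 K) ∈ w.asIdeal) :
    w.residueCard = ℓ ^ Nat.log ℓ w.residueCard := by
  obtain ⟨m, hm⟩ := exists_residueCard_eq_pow hℓ hℓw
  rw [hm, Nat.log_pow hℓ.one_lt]

variable {S : Set (PadicAlgCl p)} (θ : FramedGaloisRep K (padicCoeffIntegers S) 1) (θ' : absoluteGaloisGroup K →ₜ* (padicCoeffIntegers S)ˣ)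
  (hθ'θ : ∀ g : absoluteGaloisGroup K, ((θ' g : (padicCoeffIntegers S)ˣ) : padicCoeffIntegers S) *
    ((θ g : GL (Fin 1) (padicCoeffIntegers S)) : Matrix (Fin 1) (Fin 1) (padicCoeffIntegers S)) 0 0 = 1)

omit [NumberField K] in
include hθ'θ in
/-- With `θ'·θ₀₀ = 1`: `θ' τ = 1 ↔ θ τ = 1` (a `1 × 1` matrix is its entry). [cite: Washington1997, §13.2] -/
theorem apply_eq_one_iff_of_mul_eq_one (τ : absoluteGaloisGroup K) : θ' τ = 1 ↔ θ τ = 1 := by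
  have h := hθ'θ τ
  constructor
  · intro h1
    rw [h1, Units.val_one, one_mul] at h
    refine Units.ext (Matrix.ext fun i j ↦ ?_)
    fin_cases i; fin_cases j
    simpa using h
  · intro h1
    rw [h1, Units.val_one, Matrix.one_apply_eq, mul_one] at h
    exact Units.val_eq_one.mp h

include hθ'θ in
/-- ★ **The places of `T` over `ℓ ∈ S₀` are exactly the places over `ℓ` at which `θ` is unramified** ((R): every prime of `supp(p𝔣)` off `p` is ramified for `θ'`; (U): `θ'` is
unramified off `supp(p𝔣)`; `θ'·θ₀₀ = 1`; the places over `S₀ ∌ (p)` are off `p`). [cite: NeukirchANT1999, Ch. VI §6 Cor. (6.6)] [cite: SerreAbelianLadic1968, Ch. I §2.1] -/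
theorem mem_filter_iff_mem_and_isUnramifiedAt (𝔣 : Ideal (𝓞 K))
    (hR : ∀ w ∈ suppPF p 𝔣, ((p : ℕ) : 𝓞 K) ∉ w.asIdeal → ∃ 𝔓 ∈ w.primesAbove, ∃ τ ∈ 𝔓.inertia (absoluteGaloisGroup K), θ' τ ≠ 1)
    (hU : ∀ w : HeightOneSpectrum (𝓞 K), w ∉ suppPF p 𝔣 → ∀ 𝔓 ∈ w.primesAbove, ∀ τ ∈ 𝔓.inertia (absoluteGaloisGroup K), θ' τ = 1)
    {S₀ : Finset (HeightOneSpectrum (𝓞 ℚ))} (hS₀p : ∀ v ∈ S₀, ((p : ℕ) : 𝓞 ℚ) ∉ v.asIdeal) {T : Finset (HeightOneSpectrum (𝓞 K))}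
    (hT : ∀ w, w ∈ T ↔ (w ∈ {w : HeightOneSpectrum (𝓞 K) | ∃ v ∈ S₀, ((natGenerator v : ℕ) : 𝓞 K) ∈ w.asIdeal} ∧ w ∉ suppPF p 𝔣))
    {v : HeightOneSpectrum (𝓞 ℚ)} (hv : v ∈ S₀) (w : HeightOneSpectrum (𝓞 K)) :
    w ∈ T.filter (fun w ↦ ((natGenerator v : ℕ) : 𝓞 K) ∈ w.asIdeal) ↔ (((natGenerator v : ℕ) : 𝓞 K) ∈ w.asIdeal ∧ θ.IsUnramifiedAt w) := by
  rw [Finset.mem_filter, hT]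
  constructor
  · rintro ⟨⟨-, hwP⟩, hℓw⟩
    exact ⟨hℓw, fun 𝔓 h𝔓 τ hτ ↦ (apply_eq_one_iff_of_mul_eq_one θ θ' hθ'θ τ).mp (hU w hwP 𝔓 h𝔓 τ hτ)⟩
  · rintro ⟨hℓw, hunr⟩
    have hwS : w ∈ {w : HeightOneSpectrum (𝓞 K) | ∃ v ∈ S₀, ((natGenerator v : ℕ) : 𝓞 K) ∈ w.asIdeal} := ⟨v, hv, hℓw⟩
    refine ⟨⟨hwS, fun hwP ↦ ?_⟩, hℓw⟩
    obtain ⟨𝔓, h𝔓, τ, hτ, hne⟩ := hR w hwP (SmallImageRttJunctionLocal.natCast_not_mem_of_mem_placesAbove hS₀p hwS)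
    exact hne ((apply_eq_one_iff_of_mul_eq_one θ θ' hθ'θ τ).mpr (hunr 𝔓 h𝔓 τ hτ))

omit [Fact p.Prime] [NumberField K] in
/-- **`T` is the disjoint union over `v ∈ S₀` of its places over `ℓ_v`** (every `w ∈ T` lies over some `v ∈ S₀`; a prime of `𝓞 K` contains at most one rational prime).
[cite: Lang1990, Ch. 1 §2] -/
theorem eq_biUnion_filter {𝔣P : Set (HeightOneSpectrum (𝓞 K))} {S₀ : Finset (HeightOneSpectrum (𝓞 ℚ))} {T : Finset (HeightOneSpectrum (𝓞 K))}
    (hT : ∀ w, w ∈ T ↔ (w ∈ {w : HeightOneSpectrum (𝓞 K) | ∃ v ∈ S₀, ((natGenerator v : ℕ) : 𝓞 K) ∈ w.asIdeal} ∧ w ∉ 𝔣P)) :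
    T = S₀.biUnion (fun v ↦ T.filter (fun w ↦ ((natGenerator v : ℕ) : 𝓞 K) ∈ w.asIdeal)) := by
  ext w
  rw [Finset.mem_biUnion]
  constructor
  · intro hw
    obtain ⟨⟨v, hv, hℓw⟩, -⟩ := (hT w).mp hw
    exact ⟨v, hv, Finset.mem_filter.mpr ⟨hw, hℓw⟩⟩
  · rintro ⟨v, -, hw⟩
    exact (Finset.mem_filter.mp hw).1

omit [Fact p.Prime] in
/-- The fibres of `T` over distinct rational places are disjoint. [cite: Lang1990, Ch. 1 §2] -/
theorem pairwiseDisjoint_filter (S₀ : Finset (HeightOneSpectrum (𝓞 ℚ))) (T : Finset (HeightOneSpectrum (𝓞 K))) :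
    (S₀ : Set (HeightOneSpectrum (𝓞 ℚ))).PairwiseDisjoint (fun v ↦ T.filter (fun w ↦ ((natGenerator v : ℕ) : 𝓞 K) ∈ w.asIdeal)) := by
  intro v _ v' _ hne
  rw [Function.onFun, Finset.disjoint_left]
  intro w hw hw'
  have hℓne : natGenerator v ≠ natGenerator v' := fun h ↦ hne (primesEquiv.injective (Subtype.ext h))
  exact SmallImageRttJunctionLocal.natCast_not_mem_of_natCast_mem (prime_natGenerator v) (prime_natGenerator v') hℓne (Finset.mem_filter.mp hw).2
    (Finset.mem_filter.mp hw').2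

end Places

end Summit.BirchSwinnertonDyer.BirchSwinnertonDyer.Theorems.SmallImageRttJunctionEuler

end
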